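import Mathlib
import Summits.Ventures.HodgeRepro2.Hypothesis
import Summits.Ventures.HodgeRepro2.LevelStandardLattice
import Summits.Ventures.HodgeRepro2.DefiniteUnitaryBounded
import Summits.Ventures.HodgeRepro2.IntegralUnitaryDiscrete

/-!
# Discreteness of Shimura's level groups `Γ_N` for an arbitrary lattice

`Hypothesis.lean` (gen-0 file, p385637) states Shimura's Theorem 8.1 shape `NonVanishingInput` for
an ARBITRARY lattice `𝔪` (`IsLattice K 𝔪` = finitely generated over `ℤ` and spanning `K^m` over
`ℚ`), with the group `Γ_N = shimuraLevel K H 𝔪 N` of (4.14) and a finite-index subgroup `Γ ≤ Γ_1`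
acting on the ball through a frame.  `IntegralUnitaryDiscrete.lean` proved the discreteness of the
INTEGRAL unitary group `U(H)(𝓞_K)`; this file extends it to every lattice:

* `IsLattice.exists_nsmul_mem_standardLattice_of_mem` — `n 𝔪 ⊆ 𝓞_K^m` for some `n ≠ 0`
  (finitely many generators, denominators cleared);
* `exists_nsmul_mem_of_span_eq_top` / `IsLattice.exists_nsmul_single_mem` — `d e_i ∈ 𝔪` for some
  `d ≠ 0` (the `ℚ`-span is everything);
* `IsLattice.exists_int_ne_zero_isIntegral_mul` — hence every `γ` with `𝔪 γ ⊆ 𝔪` has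
  `D γ_{ij} ∈ 𝓞_K` for a fixed `D = nd ≠ 0`;
* `finite_of_forall_isIntegral_int_mul` — **the general finiteness statement**: for `H` definite
  at every place `≠ τ₁, \bar τ₁` and `Γ ⊆ U(H)` with `D Γ ⊆ M_m(𝓞_K)`, the elements of `Γ` whose
  `τ₁`-image has entries bounded by `C` form a finite set;
* `finite_shimuraLevel_of_forall_norm_le` / `finite_of_subset_shimuraLevel` — applied to `Γ_N` and
  its subsets, for every `IsLattice 𝔪` and every `N`;
* `isClosed_image_realEmbedding_of_subset_shimuraLevel` /
  `discreteTopology_image_realEmbedding_of_subset_shimuraLevel` — the frame image of any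
  `Γ ⊆ Γ_N` in `U(2,1)` is closed and discrete; `IsFiniteIndexSubgroupOf.subset` and
  `discreteTopology_image_realEmbedding_of_isFiniteIndexSubgroupOf` — in particular for the `Γ`
  quantified in `NonVanishingInput` (a finite-index subgroup of `Γ_1`), under `IsPicardSignature`.
-/

open Matrix NumberField

namespace Summit.Ventures.HodgeRepro2.ShimuraData

section Lattice

variable {K : Type*} [Field K] [NumberField K]

/-- A finitely generated `ℤ`-submodule of `K^m` is carried into the standard lattice `𝓞_K^m` by a
non-zero integer (the denominators of finitely many generators are cleared at once). -/
theorem IsLattice.exists_nsmul_mem_standardLattice_of_mem {m : ℕ} {𝔪 : Submodule ℤ (Fin m → K)}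
    (h : IsLattice K 𝔪) : ∃ n : ℕ, n ≠ 0 ∧ ∀ x ∈ 𝔪, n • x ∈ standardLattice K m := by
  classical
  obtain ⟨S, hS⟩ := Module.Finite.iff_fg.mp h.1
  have hg : ∀ g : Fin m → K, ∃ n : ℕ, n ≠ 0 ∧ n • g ∈ standardLattice K m :=
    exists_nsmul_mem_standardLattice
  choose nn hnn hmem using hg
  refine ⟨∏ g ∈ S, nn g, Finset.prod_ne_zero_iff.mpr fun g _ => hnn g, fun x hx => ?_⟩
  have key : 𝔪 ≤ (standardLattice K m).comap
      (LinearMap.lsmul ℤ (Fin m → K) ((∏ g ∈ S, nn g : ℕ) : ℤ)) := by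
    rw [← hS, Submodule.span_le]
    intro g hg
    rw [SetLike.mem_coe, Submodule.mem_comap, LinearMap.lsmul_apply, natCast_zsmul]
    obtain ⟨k, hk⟩ := Finset.dvd_prod_of_mem nn hg
    rw [hk, mul_nsmul]
    exact (standardLattice K m).toAddSubmonoid.nsmul_mem (hmem g) k
  have := key hx
  rwa [Submodule.mem_comap, LinearMap.lsmul_apply, natCast_zsmul] at this

/-- If a `ℤ`-submodule `𝔪` of a `ℚ`-vector space spans everything over `ℚ`, every vector has a
non-zero integer multiple in `𝔪` (clear the denominators of a `ℚ`-linear combination). -/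
theorem exists_nsmul_mem_of_span_eq_top {m : ℕ} {𝔪 : Submodule ℤ (Fin m → K)}
    (h : Submodule.span ℚ (𝔪 : Set (Fin m → K)) = ⊤) (x : Fin m → K) :
    ∃ d : ℕ, d ≠ 0 ∧ d • x ∈ 𝔪 := by
  classical
  have hx : x ∈ Submodule.span ℚ (𝔪 : Set (Fin m → K)) := by rw [h]; trivial
  obtain ⟨f, t, ht, -, hsum⟩ := Submodule.mem_span_iff_exists_finset_subset.mp hx
  refine ⟨∏ a ∈ t, (f a).den, Finset.prod_ne_zero_iff.mpr fun a _ => (f a).den_ne_zero, ?_⟩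
  set d : ℕ := ∏ a ∈ t, (f a).den with hd
  rw [← hsum, Finset.smul_sum]
  refine Submodule.sum_mem _ fun a ha => ?_
  have hdvd : (f a).den ∣ d := Finset.dvd_prod_of_mem (fun a => (f a).den) ha
  have hc : (d : ℚ) * f a = ((((d / (f a).den : ℕ) : ℤ) * (f a).num : ℤ) : ℚ) := by
    rw [Int.cast_mul, Int.cast_natCast]
    conv_lhs => rw [← Nat.div_mul_cancel hdvd, Nat.cast_mul, mul_assoc, Rat.den_mul_eq_num]
  rw [← Nat.cast_smul_eq_nsmul ℚ, smul_smul, hc, Int.cast_smul_eq_zsmul ℚ]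
  exact Submodule.smul_mem 𝔪 _ (ht ha)

/-- For a lattice `𝔪 ⊆ K^m` there is a non-zero integer `d` with `d e_i ∈ 𝔪` for every standard
basis vector `e_i`. -/
theorem IsLattice.exists_nsmul_single_mem {m : ℕ} {𝔪 : Submodule ℤ (Fin m → K)}
    (h : IsLattice K 𝔪) : ∃ d : ℕ, d ≠ 0 ∧ ∀ i : Fin m, d • Pi.single i (1 : K) ∈ 𝔪 := by
  classical
  have hi : ∀ i : Fin m, ∃ d : ℕ, d ≠ 0 ∧ d • Pi.single i (1 : K) ∈ 𝔪 := fun i =>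
    exists_nsmul_mem_of_span_eq_top h.2 _
  choose dd hdd hmem using hi
  refine ⟨∏ i, dd i, Finset.prod_ne_zero_iff.mpr fun i _ => hdd i, fun i => ?_⟩
  obtain ⟨k, hk⟩ := Finset.dvd_prod_of_mem dd (Finset.mem_univ i)
  rw [hk, mul_nsmul]
  exact 𝔪.toAddSubmonoid.nsmul_mem (hmem i) k

/-- Every matrix carrying a lattice `𝔪` into itself has entries in `D⁻¹ 𝓞_K` for a fixed non-zero
integer `D` depending on `𝔪` only. -/
theorem IsLattice.exists_int_ne_zero_isIntegral_mul {m : ℕ} {𝔪 : Submodule ℤ (Fin m → K)}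
    (h : IsLattice K 𝔪) :
    ∃ D : ℤ, D ≠ 0 ∧ ∀ γ : Matrix (Fin m) (Fin m) K, (∀ x ∈ 𝔪, x ᵥ* γ ∈ 𝔪) →
      ∀ i j, IsIntegral ℤ ((D : K) * γ i j) := by
  obtain ⟨n, hn, hnmem⟩ := h.exists_nsmul_mem_standardLattice_of_mem
  obtain ⟨d, hd, hdmem⟩ := h.exists_nsmul_single_mem
  refine ⟨((n * d : ℕ) : ℤ), by exact_mod_cast Nat.mul_ne_zero hn hd, fun γ hγ i j => ?_⟩
  have h1 : n • ((d • Pi.single i (1 : K)) ᵥ* γ) ∈ standardLattice K m :=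
    hnmem _ (hγ _ (hdmem i))
  rw [mem_standardLattice] at h1
  have h2 := h1 j
  rw [Matrix.smul_vecMul, Matrix.single_one_vecMul, Pi.smul_apply, Pi.smul_apply,
    Matrix.row_apply, nsmul_eq_mul, nsmul_eq_mul] at h2
  convert h2 using 1
  push_cast
  ring

end Lattice

section CMField

variable {K : Type*} [Field K] [NumberField K] [NumberField.IsCMField K]

/-- **General finiteness statement.**  Let `H` be a Hermitian form over the CM field `K`, definite
at every place other than that of `τ₁`, and let `Γ ⊆ U(H)` be a set of matrices whose entries all
lie in `D⁻¹ 𝓞_K` for one non-zero integer `D`.  Then the elements of `Γ` whose `τ₁`-image has all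
entries of absolute value `≤ C` form a finite set.  (`D γ_{ij}` is an algebraic integer with all
conjugates bounded by `|D| B`, `B` the bound of `IntegralUnitaryDiscrete.lean`.) -/
theorem finite_of_forall_isIntegral_int_mul {m : ℕ} {H : Matrix (Fin m) (Fin m) K}
    (hH : IsHermitianForm K H) (τ₁ : K →+* ℂ)
    (hdef : ∀ τ : K →+* ℂ, InfinitePlace.mk τ ≠ InfinitePlace.mk τ₁ → IsDefiniteAt K τ H)
    {Γ : Set (GL (Fin m) K)} (hΓ : ∀ γ ∈ Γ, γ ∈ unitaryGroup K H) {D : ℤ} (hD : D ≠ 0)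
    (hint : ∀ γ ∈ Γ, ∀ i j, IsIntegral ℤ ((D : K) * (γ : Matrix (Fin m) (Fin m) K) i j))
    (C : ℝ) :
    {γ : GL (Fin m) K | γ ∈ Γ ∧
      ∀ i j, ‖((γ : Matrix (Fin m) (Fin m) K).map τ₁) i j‖ ≤ C}.Finite := by
  classical
  -- a bound at every place
  have hb : ∀ τ : K →+* ℂ, ∃ c : ℝ, InfinitePlace.mk τ ≠ InfinitePlace.mk τ₁ →
      ∀ γ ∈ unitaryGroup K H, ∀ i j, ‖((γ : Matrix (Fin m) (Fin m) K).map τ) i j‖ ≤ c := by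
    intro τ
    by_cases hτ : InfinitePlace.mk τ = InfinitePlace.mk τ₁
    · exact ⟨0, fun h => absurd hτ h⟩
    · obtain ⟨c, hc⟩ := exists_entry_bound_of_isDefiniteAt hH (hdef τ hτ)
      exact ⟨c, fun _ => hc⟩
  choose c hc using hb
  set B : ℝ := |C| + ∑ τ : K →+* ℂ, |c τ| with hBdef
  have hCB : C ≤ B := by
    have : 0 ≤ ∑ τ : K →+* ℂ, |c τ| := Finset.sum_nonneg fun _ _ => abs_nonneg _
    linarith [le_abs_self C]
  have hcB : ∀ τ, c τ ≤ B := fun τ => by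
    have : |c τ| ≤ ∑ τ' : K →+* ℂ, |c τ'| :=
      Finset.single_le_sum (f := fun τ' => |c τ'|) (fun _ _ => abs_nonneg _) (Finset.mem_univ τ)
    linarith [le_abs_self (c τ), abs_nonneg C]
  -- the finite set of algebraic integers with all conjugates bounded by `|D| B`
  have hS := NumberField.Embeddings.finite_of_norm_le K ℂ (|(D : ℝ)| * B)
  set S : Set K := {x : K | IsIntegral ℤ x ∧ ∀ φ : K →+* ℂ, ‖φ x‖ ≤ |(D : ℝ)| * B} with hSdef
  have hT : (Set.univ.pi fun _ : Fin m => Set.univ.pi fun _ : Fin m => S).Finite :=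
    Set.Finite.pi fun _ => Set.Finite.pi fun _ => hS
  -- the injective map `γ ↦ D γ`
  have hDK : (D : K) ≠ 0 := Int.cast_ne_zero.mpr hD
  have hinj : Function.Injective
      (fun γ : GL (Fin m) K => fun i j => (D : K) * (γ : Matrix (Fin m) (Fin m) K) i j) := by
    intro γ γ' hγ
    apply Units.ext
    ext i j
    have := congrFun (congrFun hγ i) j
    exact mul_left_cancel₀ hDK this
  refine (hT.preimage hinj.injOn).subset ?_
  rintro γ ⟨hγΓ, hγC⟩
  refine Set.mem_univ_pi.mpr fun i => Set.mem_univ_pi.mpr fun j => ?_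
  refine ⟨hint γ hγΓ i j, fun φ => ?_⟩
  show ‖φ ((D : K) * (γ : Matrix (Fin m) (Fin m) K) i j)‖ ≤ |(D : ℝ)| * B
  rw [map_mul, map_intCast, norm_mul, Complex.norm_intCast]
  refine mul_le_mul_of_nonneg_left ?_ (abs_nonneg _)
  have hC1 : ‖τ₁ ((γ : Matrix (Fin m) (Fin m) K) i j)‖ ≤ C := by
    have := hγC i j
    rwa [Matrix.map_apply] at this
  by_cases hφ : InfinitePlace.mk φ = InfinitePlace.mk τ₁
  · rcases InfinitePlace.mk_eq_iff.mp hφ with hφeq | hconj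
    · rw [hφeq]; exact hC1.trans hCB
    · have e : ‖τ₁ ((γ : Matrix (Fin m) (Fin m) K) i j)‖ =
          ‖φ ((γ : Matrix (Fin m) (Fin m) K) i j)‖ := by
        rw [← hconj, ComplexEmbedding.conjugate_coe_eq, Complex.norm_conj]
      rw [← e]; exact hC1.trans hCB
  · have := hc φ hφ γ (hΓ γ hγΓ) i j
    rw [Matrix.map_apply] at this
    exact this.trans (hcB φ)

/-- Bounded subsets of Shimura's `Γ_N = shimuraLevel K H 𝔪 N` are finite, for every lattice `𝔪`. -/
theorem finite_shimuraLevel_of_forall_norm_le {m : ℕ} {H : Matrix (Fin m) (Fin m) K}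
    (hH : IsHermitianForm K H) (τ₁ : K →+* ℂ)
    (hdef : ∀ τ : K →+* ℂ, InfinitePlace.mk τ ≠ InfinitePlace.mk τ₁ → IsDefiniteAt K τ H)
    {𝔪 : Submodule ℤ (Fin m → K)} (h𝔪 : IsLattice K 𝔪) (N : ℕ) (C : ℝ) :
    {γ : GL (Fin m) K | γ ∈ shimuraLevel K H 𝔪 N ∧
      ∀ i j, ‖((γ : Matrix (Fin m) (Fin m) K).map τ₁) i j‖ ≤ C}.Finite := by
  obtain ⟨D, hD, hint⟩ := h𝔪.exists_int_ne_zero_isIntegral_mul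
  exact finite_of_forall_isIntegral_int_mul hH τ₁ hdef (fun γ hγ => hγ.1.1) hD
    (fun γ hγ => hint _ hγ.2.1) C

/-- Bounded subsets of any `Γ ⊆ Γ_N` are finite. -/
theorem finite_of_subset_shimuraLevel {m : ℕ} {H : Matrix (Fin m) (Fin m) K}
    (hH : IsHermitianForm K H) (τ₁ : K →+* ℂ)
    (hdef : ∀ τ : K →+* ℂ, InfinitePlace.mk τ ≠ InfinitePlace.mk τ₁ → IsDefiniteAt K τ H)
    {𝔪 : Submodule ℤ (Fin m → K)} (h𝔪 : IsLattice K 𝔪) {N : ℕ} {Γ : Set (GL (Fin m) K)}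
    (hΓ : Γ ⊆ shimuraLevel K H 𝔪 N) (C : ℝ) :
    {γ : GL (Fin m) K | γ ∈ Γ ∧
      ∀ i j, ‖((γ : Matrix (Fin m) (Fin m) K).map τ₁) i j‖ ≤ C}.Finite :=
  (finite_shimuraLevel_of_forall_norm_le hH τ₁ hdef h𝔪 N C).subset
    fun _ ⟨hγ, hC⟩ => ⟨hΓ hγ, hC⟩

/-- Bounded subsets of the frame image `realEmbedding K τ₁ Q '' Γ ⊆ U(2,1)` of any `Γ ⊆ Γ_N` are
finite. -/
theorem finite_image_realEmbedding_of_subset_shimuraLevel {τ₁ : K →+* ℂ}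
    {H : Matrix (Fin 3) (Fin 3) K} (hH : IsHermitianForm K H)
    (hdef : ∀ τ : K →+* ℂ, InfinitePlace.mk τ ≠ InfinitePlace.mk τ₁ → IsDefiniteAt K τ H)
    {Q : Matrix (Fin 3) (Fin 3) ℂ} (hQ : IsFrame K τ₁ H Q) {𝔪 : Submodule ℤ (Fin 3 → K)}
    (h𝔪 : IsLattice K 𝔪) {N : ℕ} {Γ : Set (GL (Fin 3) K)} (hΓ : Γ ⊆ shimuraLevel K H 𝔪 N)
    (C : ℝ) : {M ∈ realEmbedding K τ₁ Q '' Γ | ∀ i j, ‖M i j‖ ≤ C}.Finite := by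
  refine ((finite_of_subset_shimuraLevel hH τ₁ hdef h𝔪 hΓ
    ((3 * 3 : ℝ) * (entrySum Q⁻¹ * ((3 * 3 : ℝ) * C)) * entrySum Q)).image
    (realEmbedding K τ₁ Q)).subset ?_
  rintro M ⟨⟨γ, hγ, rfl⟩, hM⟩
  exact ⟨γ, ⟨hγ, norm_map_apply_le_of_realEmbedding_le hQ γ hM⟩, rfl⟩

/-- **The frame image of any `Γ ⊆ Γ_N` is closed in `M_3(ℂ)`.** -/
theorem isClosed_image_realEmbedding_of_subset_shimuraLevel {τ₁ : K →+* ℂ}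
    {H : Matrix (Fin 3) (Fin 3) K} (hH : IsHermitianForm K H)
    (hdef : ∀ τ : K →+* ℂ, InfinitePlace.mk τ ≠ InfinitePlace.mk τ₁ → IsDefiniteAt K τ H)
    {Q : Matrix (Fin 3) (Fin 3) ℂ} (hQ : IsFrame K τ₁ H Q) {𝔪 : Submodule ℤ (Fin 3 → K)}
    (h𝔪 : IsLattice K 𝔪) {N : ℕ} {Γ : Set (GL (Fin 3) K)} (hΓ : Γ ⊆ shimuraLevel K H 𝔪 N) :
    IsClosed (realEmbedding K τ₁ Q '' Γ) :=
  isClosed_of_forall_finite_bounded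
    (finite_image_realEmbedding_of_subset_shimuraLevel hH hdef hQ h𝔪 hΓ)

/-- **The frame image of any `Γ ⊆ Γ_N` is a discrete subset of `U(2,1)`.** -/
theorem discreteTopology_image_realEmbedding_of_subset_shimuraLevel {τ₁ : K →+* ℂ}
    {H : Matrix (Fin 3) (Fin 3) K} (hH : IsHermitianForm K H)
    (hdef : ∀ τ : K →+* ℂ, InfinitePlace.mk τ ≠ InfinitePlace.mk τ₁ → IsDefiniteAt K τ H)
    {Q : Matrix (Fin 3) (Fin 3) ℂ} (hQ : IsFrame K τ₁ H Q) {𝔪 : Submodule ℤ (Fin 3 → K)}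
    (h𝔪 : IsLattice K 𝔪) {N : ℕ} {Γ : Set (GL (Fin 3) K)} (hΓ : Γ ⊆ shimuraLevel K H 𝔪 N) :
    DiscreteTopology (realEmbedding K τ₁ Q '' Γ) :=
  discreteTopology_of_forall_finite_bounded
    (finite_image_realEmbedding_of_subset_shimuraLevel hH hdef hQ h𝔪 hΓ)

omit [NumberField K] [NumberField.IsCMField K] in
/-- A finite-index subgroup in the sense of `IsFiniteIndexSubgroupOf` is in particular a subset. -/
theorem IsFiniteIndexSubgroupOf.subset {m : ℕ} {Γ Γ₁ : Set (GL (Fin m) K)}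
    (h : IsFiniteIndexSubgroupOf K Γ Γ₁) : Γ ⊆ Γ₁ := by
  obtain ⟨S, T, rfl, rfl, hST, -⟩ := h
  exact SetLike.coe_subset_coe.mpr hST

/-- **The group of `NonVanishingInput` acts discretely.**  For a Picard signature at `τ₁`, a lattice
`𝔪`, a frame `Q` and a finite-index subgroup `Γ` of `Γ_1` — exactly the data quantified in
`NonVanishingInput` / `ShimuraThm81Instance` of `Hypothesis.lean` — the frame image of `Γ` is a
discrete subset of `U(2,1)`. -/
theorem discreteTopology_image_realEmbedding_of_isFiniteIndexSubgroupOf {τ₁ : K →+* ℂ}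
    {H : Matrix (Fin 3) (Fin 3) K} (hH : IsHermitianForm K H) (hP : IsPicardSignature K τ₁ H)
    {Q : Matrix (Fin 3) (Fin 3) ℂ} (hQ : IsFrame K τ₁ H Q) {𝔪 : Submodule ℤ (Fin 3 → K)}
    (h𝔪 : IsLattice K 𝔪) {Γ : Set (GL (Fin 3) K)}
    (hΓ : IsFiniteIndexSubgroupOf K Γ (shimuraLevel K H 𝔪 1)) :
    DiscreteTopology (realEmbedding K τ₁ Q '' Γ) :=
  discreteTopology_image_realEmbedding_of_subset_shimuraLevel hH hP.isDefiniteAt_of_ne hQ h𝔪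
    hΓ.subset

/-- The same for closedness. -/
theorem isClosed_image_realEmbedding_of_isFiniteIndexSubgroupOf {τ₁ : K →+* ℂ}
    {H : Matrix (Fin 3) (Fin 3) K} (hH : IsHermitianForm K H) (hP : IsPicardSignature K τ₁ H)
    {Q : Matrix (Fin 3) (Fin 3) ℂ} (hQ : IsFrame K τ₁ H Q) {𝔪 : Submodule ℤ (Fin 3 → K)}
    (h𝔪 : IsLattice K 𝔪) {Γ : Set (GL (Fin 3) K)}
    (hΓ : IsFiniteIndexSubgroupOf K Γ (shimuraLevel K H 𝔪 1)) :
    IsClosed (realEmbedding K τ₁ Q '' Γ) :=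
  isClosed_image_realEmbedding_of_subset_shimuraLevel hH hP.isDefiniteAt_of_ne hQ h𝔪 hΓ.subset

end CMField

end Summit.Ventures.HodgeRepro2.ShimuraData
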